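import Summits.NavierStokesRegularity.NavierStokesRegularity.Theorems.ExtremiserTransienceAnalyticGapOfPlateauSpread
import Summits.NavierStokesRegularity.NavierStokesRegularity.Theorems.ExtremiserTransienceAnalyticPlateauSpread
import Literature.Analysis.PDE.AnalyticPropagationOfSmallnessHolds
import HarnessLib

/-!
# Route `ExtremiserTransience`, crux `NearExtremalTransiencePerFlow` (stmt-NavierStokesRegularity-26567),
# LINE g8-β «analytic gap»: P-F DISCHARGED — the sparse analytic gap `SparseAnalyticGap` is UNCONDITIONAL

`--supports stmt-NavierStokesRegularity-26567` (helper).  Author: prover seat `ns-net-p2` (g3).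

The line's single Literature dependency P-F (`AnalyticPropagationOfSmallness`, = the named fact
`Literature.Analysis.PDE.analyticPropagationOfSmallness 3`, Apraiz–Escauriaza–Wang–Zhang 2014 Thm 4 / Vessella 1999) is
now a THEOREM of the tree (`Literature.Analysis.PDE.analyticPropagationOfSmallness_holds`, proved by Taylor + weak Remez +
interval chain + Brudnyi–Ganzburg ray slicing).  Consequences, BY NAME over the texts of record (`…AnalyticGapDefs`):
* `analyticPropagationOfSmallness_holds` — P-F holds;
* `analyticPlateauSpread_holds` — P-R's conclusion `AnalyticPlateauSpread` holds (via the landed `analyticPlateauSpread_of_propagation`);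
* `sparseAnalyticGap_holds` — **G `SparseAnalyticGap` holds unconditionally**: for every `ρ ∈ (0,1]` and `N₀ > 0` there is
  `ε > 0` such that every admissible, `ρ`-analytic-regular, `N₀`-sparse, non-degenerate field on `ℝ³` has
  `|J| ≤ (κ⋆ − ε)·M·√Z·√W` — a uniform efficiency gap on the sparse analytic class (S-B, P-C, P-R landed earlier);
* (not restated here: `SparseEfficientTimes → NearExtremalTransiencePerFlow` is ALREADY the landed
  `SparseBangBang.nearExtremalTransiencePerFlow_of_sparseEfficientTimes` of LINE g8-α — same statement; via β it is
  `nearExtremalTransiencePerFlow_of_plateauSpread analyticPlateauSpread_holds`).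
HONEST FRAMING: `SparseAnalyticGap` is an unconditional theorem about the depletion functional; the crux 26567 still rests on the
open heart S-E (`SparseEfficientTimes`); nothing about Navier–Stokes regularity is proved; no summit is proved by a line. [folklore]
-/

noncomputable section

namespace Summit.NavierStokesRegularity.NavierStokesRegularity.Theorems

-- the problem directory repeats the summit name (`NavierStokesRegularity/NavierStokesRegularity`)
set_option linter.dupNamespace false

namespace NearExtremalTransiencePerFlow.AnalyticGap

/-- **P-F holds**: the workfile Prop `AnalyticPropagationOfSmallness` (= `analyticPropagationOfSmallness 3`) is a theorem.
[cite: ApraizEscauriazaWangZhang2014, Theorem 4] -/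
theorem analyticPropagationOfSmallness_holds : AnalyticPropagationOfSmallness :=
  analyticPropagationOfSmallness_of_literature (Literature.Analysis.PDE.analyticPropagationOfSmallness_holds 3)

/-- **P-R's conclusion holds**: `AnalyticPlateauSpread` (δ-near-top fat ball ⇒ η-near-top on any fixed larger ball, for
`ρ`-analytic-regular fields), unconditionally. [folklore] -/
theorem analyticPlateauSpread_holds : AnalyticPlateauSpread :=
  analyticPlateauSpread_of_propagation analyticPropagationOfSmallness_holds

/-- **G holds — the SPARSE ANALYTIC GAP is unconditional**: `SparseAnalyticGap`, i.e. for `0 < ρ ≤ 1`, `N₀ > 0` there is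
`ε > 0` with `|Jst v| ≤ (kStar − ε)·M·√(Zen v)·√(Wpa v)` for every `IsAdm v M B`, `IsAnalyticReg ρ v M`, `IsSparse N₀ v M`
field with `0 < M·√Z·√W`. [folklore] -/
theorem sparseAnalyticGap_holds : SparseAnalyticGap :=
  sparseAnalyticGap_of_plateauSpread analyticPlateauSpread_holds

end NearExtremalTransiencePerFlow.AnalyticGap

end Summit.NavierStokesRegularity.NavierStokesRegularity.Theorems

end
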